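import Literature.MathematicalPhysics.QuantumFieldTheory.QCDSpinDiagonalBasis
import HarnessLib

/-!
# Towards `WilsonQCDSiteReflectionPositivityAP`: generator bookkeeping in the `γ₀`-diagonal frame

Theorem-and-helper companion of `QCDSpinDiagonalBasis` (the spin rotation `R' = spinUnrot` of the
torus quark Grassmann algebra diagonalising `γ₀`, and the rotated Osterwalder–Seiler reflection
`Θ' = fermiThetaRot`, a `GrassmannAlgebra.Reflection` acting on generators as a signed permutation,
`fermiThetaRot_q` / `fermiThetaRot_qbar`) and of `QCDTimeReflectionProofs` (`Θ_T`, `thetaMatrix`).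
For the site-reflection positivity argument of Montvay–Münster §4.2.3 ((4.100)–(4.111)) one needs the
reflection as a map of generator INDICES and the time classes of generators:

* `idxSpin`, `idxTime`, `idxRefl`, `genIdx`, `genTimeT`, `reflGen`, `genSign` — spin, time and
  reflection partner of a quark variable / of a generator slot; `fermiThetaRot_gen :
  Θ' (gen w) = genSign w • gen (reflGen w)` (the hypothesis `hΘ` of the abstract top-pairing lemmas of
  `GrassmannReflectionPositivity` / `GrassmannSiteReflectionPairing`), `reflGen` an involution;
* `posGens`, `negGens`, `zeroGens` (times `1 ≤ t ≤ L/2`, `L/2 < t`, `t = 0`), pairwise disjoint,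
  `zeroGens = (posGens ∪ negGens)ᶜ`, `image_reflGen_posGens : σ(P) = N` (`L` odd), the slice is
  `σ`-stable; `upperGens` / `lowerGens` (Montvay–Münster (4.102): `P⁺ψ₀, ψ̄₀P⁻` versus `ψ̄₀P⁺, P⁻ψ₀`,
  which in the diagonal frame are plain generators: `ψ_{x,r}` (`r < 2`), `ψ̄_{x,r}` (`2 ≤ r`)), swapped
  by `σ`;
* `fermiThetaRot_quadratic : Θ' (ψ̄Aψ) = ψ̄ A^{Θ'} ψ` (`thetaMatrixRot`), `spinUnrot_quadratic`,
  `thetaMatrixRot_rot` (the rotated reflected matrix is the rotation of `thetaMatrix`);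
* `spinUnrot_onTorus_mem` — a positive-time local observable (`IsPositiveTime`, quark box radius
  `R` with `2R < L`), placed on the torus and rotated, lies in the subalgebra generated by the
  positive-time generators (a spectator of `negGens ∪ zeroGens`).

References: I. Montvay, G. Münster, *Quantum Fields on a Lattice* (CUP 1994) §4.2.3 (4.99)–(4.104);
M. Lüscher, Commun. Math. Phys. 54 (1977) 283. All statements here are proved; the `def`s are index
bookkeeping, no named fact is introduced.
-/

open MeasureTheory
open scoped Matrix ComplexConjugate
open Literature.Probability Literature.Probability.LatticeModels Literature.MathematicalPhysics.QuantumLattice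

noncomputable section

namespace Literature.MathematicalPhysics.QuantumFieldTheory

/-! ### Generator indices: spin, time, the reflection partner -/

section Indices

open GrassmannAlgebra

variable {Nf L : ℕ} [NeZero L]

/-- The spin index of a torus quark variable. [folklore] -/
def idxSpin (i : FermiIdx Nf L) : Fin 4 := (quarkEquiv.symm i).2.2.2

/-- The time coordinate (as a natural number `0 ≤ t < L`) of a torus quark variable. [folklore] -/
def idxTime (i : FermiIdx Nf L) : ℕ := ((quarkEquiv.symm i).2.1 0).val

/-- The site-reflected partner of a torus quark variable (same flavour, colour, spin). [folklore] -/
def idxRefl (i : FermiIdx Nf L) : FermiIdx Nf L :=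
  quarkEquiv ((quarkEquiv.symm i).1, (Site.negReflect (quarkEquiv.symm i).2.1, (quarkEquiv.symm i).2.2.1,
    (quarkEquiv.symm i).2.2.2))

/-- `idxSpin` on an enumerated variable. [folklore] -/
@[simp] theorem idxSpin_quarkEquiv (v : QuarkVar Nf L) : idxSpin (quarkEquiv v) = v.2.2.2 := by
  simp [idxSpin]

/-- `idxTime` on an enumerated variable. [folklore] -/
@[simp] theorem idxTime_quarkEquiv (v : QuarkVar Nf L) : idxTime (quarkEquiv v) = (v.2.1 0).val := by
  simp [idxTime]

/-- `idxRefl` on an enumerated variable. [folklore] -/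
@[simp] theorem idxRefl_quarkEquiv (v : QuarkVar Nf L) :
    idxRefl (quarkEquiv v) = quarkEquiv (v.1, (Site.negReflect v.2.1, v.2.2.1, v.2.2.2)) := by
  simp [idxRefl]

/-- The reflection partner is an involution. [folklore] -/
@[simp] theorem idxRefl_idxRefl (i : FermiIdx Nf L) : idxRefl (idxRefl i) = i := by
  obtain ⟨v, rfl⟩ := quarkEquiv.surjective i
  obtain ⟨f, x, a, r⟩ := v
  simp [WilsonSiteRP.negReflect_negReflect]

/-- The reflected variable has the same spin. [folklore] -/
@[simp] theorem idxSpin_idxRefl (i : FermiIdx Nf L) : idxSpin (idxRefl i) = idxSpin i := by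
  obtain ⟨v, rfl⟩ := quarkEquiv.surjective i
  simp

/-- The time of the reflected variable: `0 ↦ 0`, `t ↦ L − t`. [folklore] -/
theorem idxTime_idxRefl (i : FermiIdx Nf L) :
    idxTime (idxRefl i) = if idxTime i = 0 then 0 else L - idxTime i := by
  obtain ⟨v, rfl⟩ := quarkEquiv.surjective i
  simp only [idxRefl_quarkEquiv, idxTime_quarkEquiv, WilsonSiteRP.negReflect_apply_zero, ZMod.neg_val]
  by_cases h : v.2.1 0 = 0
  · rw [if_pos h, if_pos (by rw [h, ZMod.val_zero])]
  · rw [if_neg h, if_neg (fun h' => h ((ZMod.val_eq_zero _).1 h'))]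

/-- The quark variable behind a generator index (`ψ̄` or `ψ` slot). [folklore] -/
def genIdx (w : FermiIdx Nf L ⊕ₗ FermiIdx Nf L) : FermiIdx Nf L := Sum.elim id id (ofLex w)

/-- The time of a generator. [folklore] -/
def genTimeT (w : FermiIdx Nf L ⊕ₗ FermiIdx Nf L) : ℕ := idxTime (genIdx w)

/-- **The reflection partner of a generator**: `ψ̄_{f,x,a,r} ↔ ψ_{f,θx,a,r}`. [folklore] -/
def reflGen (w : FermiIdx Nf L ⊕ₗ FermiIdx Nf L) : FermiIdx Nf L ⊕ₗ FermiIdx Nf L :=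
  match ofLex w with
  | Sum.inl i => toLex (Sum.inr (idxRefl i))
  | Sum.inr i => toLex (Sum.inl (idxRefl i))

/-- The sign `ε` of a generator (that of its spin). [folklore] -/
def genSign (w : FermiIdx Nf L ⊕ₗ FermiIdx Nf L) : ℂ := spinSign (idxSpin (genIdx w))

/-- `reflGen` on a `ψ̄`-slot. [folklore] -/
@[simp] theorem reflGen_inl (i : FermiIdx Nf L) :
    reflGen (toLex (Sum.inl i)) = toLex (Sum.inr (idxRefl i)) := rfl

/-- `reflGen` on a `ψ`-slot. [folklore] -/
@[simp] theorem reflGen_inr (i : FermiIdx Nf L) :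
    reflGen (toLex (Sum.inr i)) = toLex (Sum.inl (idxRefl i)) := rfl

/-- `genIdx` on a `ψ̄`-slot. [folklore] -/
@[simp] theorem genIdx_inl (i : FermiIdx Nf L) : genIdx (toLex (Sum.inl i)) = i := rfl

/-- `genIdx` on a `ψ`-slot. [folklore] -/
@[simp] theorem genIdx_inr (i : FermiIdx Nf L) : genIdx (toLex (Sum.inr i)) = i := rfl

/-- `reflGen` is an involution. [folklore] -/
@[simp] theorem reflGen_reflGen (w : FermiIdx Nf L ⊕ₗ FermiIdx Nf L) : reflGen (reflGen w) = w := by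
  rcases h : ofLex w with i | i
  · have hw : w = toLex (Sum.inl i) := by rw [← h, toLex_ofLex]
    subst hw; simp
  · have hw : w = toLex (Sum.inr i) := by rw [← h, toLex_ofLex]
    subst hw; simp

/-- `reflGen` is injective. [folklore] -/
theorem reflGen_injective : Function.Injective (reflGen (Nf := Nf) (L := L)) :=
  Function.Involutive.injective reflGen_reflGen

/-- The variable behind the reflected generator is the reflected variable. [folklore] -/
@[simp] theorem genIdx_reflGen (w : FermiIdx Nf L ⊕ₗ FermiIdx Nf L) : genIdx (reflGen w) = idxRefl (genIdx w) := by
  rcases h : ofLex w with i | i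
  · have hw : w = toLex (Sum.inl i) := by rw [← h, toLex_ofLex]
    subst hw; simp
  · have hw : w = toLex (Sum.inr i) := by rw [← h, toLex_ofLex]
    subst hw; simp

/-- The time of the reflected generator. [folklore] -/
theorem genTimeT_reflGen (w : FermiIdx Nf L ⊕ₗ FermiIdx Nf L) :
    genTimeT (reflGen w) = if genTimeT w = 0 then 0 else L - genTimeT w := by
  simp only [genTimeT, genIdx_reflGen, idxTime_idxRefl]

/-- The time of a generator is `< L`. [folklore] -/
theorem genTimeT_lt (w : FermiIdx Nf L ⊕ₗ FermiIdx Nf L) : genTimeT w < L := ZMod.val_lt _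

/-- **`Θ'` is a monomial reflection**: `Θ' (gen w) = ε_w • gen (σ w)`. [cite: MontvayMunster1994, §4.2.3 (4.99)] -/
theorem fermiThetaRot_gen (w : FermiIdx Nf L ⊕ₗ FermiIdx Nf L) :
    fermiThetaRot (gen ℂ w) = genSign w • gen ℂ (reflGen w) := by
  rcases h : ofLex w with i | i
  · have hw : w = toLex (Sum.inl i) := by rw [← h, toLex_ofLex]
    subst hw
    obtain ⟨v, rfl⟩ := quarkEquiv.surjective i
    obtain ⟨f, x, a, m⟩ := v
    change fermiThetaRot (qbar (f, (x, a, m))) = _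
    rw [fermiThetaRot_qbar]
    simp [genSign, q, psi]
  · have hw : w = toLex (Sum.inr i) := by rw [← h, toLex_ofLex]
    subst hw
    obtain ⟨v, rfl⟩ := quarkEquiv.surjective i
    obtain ⟨f, x, a, m⟩ := v
    change fermiThetaRot (q (f, (x, a, m))) = _
    rw [fermiThetaRot_q]
    simp [genSign, qbar, psiBar]

/-! ### Time classes of generators -/

variable (Nf L) in
/-- Generators at strictly positive times `1 ≤ t ≤ L/2`. [folklore] -/
def posGens : Finset (FermiIdx Nf L ⊕ₗ FermiIdx Nf L) :=
  Finset.univ.filter fun w => 1 ≤ genTimeT w ∧ genTimeT w ≤ L / 2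

variable (Nf L) in
/-- Generators at negative times `L/2 < t` (`t ∈ {L/2+1, …, L−1}`). [folklore] -/
def negGens : Finset (FermiIdx Nf L ⊕ₗ FermiIdx Nf L) :=
  Finset.univ.filter fun w => L / 2 < genTimeT w

variable (Nf L) in
/-- Generators of the reflection slice `t = 0`. [folklore] -/
def zeroGens : Finset (FermiIdx Nf L ⊕ₗ FermiIdx Nf L) :=
  Finset.univ.filter fun w => genTimeT w = 0

/-- Membership in `posGens`. [folklore] -/
@[simp] theorem mem_posGens {w : FermiIdx Nf L ⊕ₗ FermiIdx Nf L} :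
    w ∈ posGens Nf L ↔ 1 ≤ genTimeT w ∧ genTimeT w ≤ L / 2 := by simp [posGens]

/-- Membership in `negGens`. [folklore] -/
@[simp] theorem mem_negGens {w : FermiIdx Nf L ⊕ₗ FermiIdx Nf L} :
    w ∈ negGens Nf L ↔ L / 2 < genTimeT w := by simp [negGens]

/-- Membership in `zeroGens`. [folklore] -/
@[simp] theorem mem_zeroGens {w : FermiIdx Nf L ⊕ₗ FermiIdx Nf L} :
    w ∈ zeroGens Nf L ↔ genTimeT w = 0 := by simp [zeroGens]

/-- The three time classes are pairwise disjoint. [folklore] -/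
theorem disjoint_posGens_negGens : Disjoint (posGens Nf L) (negGens Nf L) := by
  rw [Finset.disjoint_left]; intro w h1 h2
  rw [mem_posGens] at h1; rw [mem_negGens] at h2; omega

/-- `P ∩ Z = ∅`. [folklore] -/
theorem disjoint_posGens_zeroGens : Disjoint (posGens Nf L) (zeroGens Nf L) := by
  rw [Finset.disjoint_left]; intro w h1 h2
  rw [mem_posGens] at h1; rw [mem_zeroGens] at h2; omega

/-- `Z ∩ N = ∅`. [folklore] -/
theorem disjoint_zeroGens_negGens : Disjoint (zeroGens Nf L) (negGens Nf L) := by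
  rw [Finset.disjoint_left]; intro w h1 h2
  rw [mem_zeroGens] at h1; rw [mem_negGens] at h2; omega

/-- Every generator is in exactly one class; the slice is the complement of `P ∪ N`. [folklore] -/
theorem mem_zeroGens_iff_not_mem (w : FermiIdx Nf L ⊕ₗ FermiIdx Nf L) :
    w ∈ zeroGens Nf L ↔ w ∉ posGens Nf L ∪ negGens Nf L := by
  rw [mem_zeroGens, Finset.mem_union, mem_posGens, mem_negGens]; omega

/-- `Z = (P ∪ N)ᶜ`. [folklore] -/
theorem zeroGens_eq_compl : zeroGens Nf L = (posGens Nf L ∪ negGens Nf L)ᶜ := by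
  ext w; rw [Finset.mem_compl, mem_zeroGens_iff_not_mem]

/-- **The reflection maps the positive class onto the negative class** (`L` odd). [folklore] -/
theorem image_reflGen_posGens (hL : Odd L) : (posGens Nf L).image reflGen = negGens Nf L := by
  obtain ⟨k, hk⟩ := hL
  ext w
  rw [Finset.mem_image, mem_negGens]
  constructor
  · rintro ⟨u, hu, rfl⟩
    rw [mem_posGens] at hu
    rw [genTimeT_reflGen, if_neg (by omega)]
    omega
  · intro hw
    refine ⟨reflGen w, ?_, reflGen_reflGen w⟩
    have hlt := genTimeT_lt w
    rw [mem_posGens, genTimeT_reflGen, if_neg (by omega)]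
    omega

/-- The reflection preserves the slice. [folklore] -/
theorem reflGen_mem_zeroGens {w : FermiIdx Nf L ⊕ₗ FermiIdx Nf L} (hw : w ∈ zeroGens Nf L) :
    reflGen w ∈ zeroGens Nf L := by
  rw [mem_zeroGens] at hw ⊢
  rw [genTimeT_reflGen, if_pos hw]

/-- The slice-preservation in the form used by the abstract slice lemmas. [folklore] -/
theorem reflGen_not_mem_union {w : FermiIdx Nf L ⊕ₗ FermiIdx Nf L}
    (hw : w ∉ posGens Nf L ∪ negGens Nf L) : reflGen w ∉ posGens Nf L ∪ negGens Nf L := by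
  rw [← mem_zeroGens_iff_not_mem] at hw ⊢
  exact reflGen_mem_zeroGens hw

/-- `Θ' θ_P = c_N θ_N` for a constant `c_N`. [folklore] -/
theorem exists_fermiThetaRot_basis_posGens (hL : Odd L) : ∃ cN : ℂ,
    fermiThetaRot (grassmannBasis ℂ _ (posGens Nf L)) = cN • grassmannBasis ℂ _ (negGens Nf L) := by
  obtain ⟨c, hc⟩ := exists_map_grassmannBasis_eq_smul fermiThetaRot (P := Finset.univ) (σ := reflGen)
    (ε := genSign) (fun w _ => fermiThetaRot_gen w) reflGen_injective.injOn (Finset.subset_univ (posGens Nf L))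
  refine ⟨c, ?_⟩
  rw [hc]
  congr 2
  exact image_reflGen_posGens hL

/-! ### Upper and lower slice variables -/

/-- The UPPER slice variables (those coupled to positive times by the temporal hopping term):
`ψ_{x,r}` with `r < 2` (`P⁺ψ`) and `ψ̄_{x,r}` with `2 ≤ r` (`ψ̄P⁻`), `x` in the slice `t = 0`
(Montvay–Münster (4.102): `ξ = P⁺ψ₀`, `η ∝ ψ̄₀P⁻`). [cite: MontvayMunster1994, §4.2.3 (4.102)] -/
def IsUpper (w : FermiIdx Nf L ⊕ₗ FermiIdx Nf L) : Prop :=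
  match ofLex w with
  | Sum.inl i => 2 ≤ (idxSpin i).val
  | Sum.inr i => (idxSpin i).val < 2

/-- `IsUpper` is decidable. [folklore] -/
instance : DecidablePred (IsUpper (Nf := Nf) (L := L)) := fun w => by
  unfold IsUpper; rcases ofLex w with i | i <;> infer_instance

/-- `IsUpper` on a `ψ̄`-slot. [folklore] -/
@[simp] theorem isUpper_inl (i : FermiIdx Nf L) : IsUpper (toLex (Sum.inl i)) ↔ 2 ≤ (idxSpin i).val := Iff.rfl

/-- `IsUpper` on a `ψ`-slot. [folklore] -/
@[simp] theorem isUpper_inr (i : FermiIdx Nf L) : IsUpper (toLex (Sum.inr i)) ↔ (idxSpin i).val < 2 := Iff.rfl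

/-- The reflection swaps upper and lower. [folklore] -/
theorem isUpper_reflGen (w : FermiIdx Nf L ⊕ₗ FermiIdx Nf L) : IsUpper (reflGen w) ↔ ¬ IsUpper w := by
  rcases h : ofLex w with i | i
  · have hw : w = toLex (Sum.inl i) := by rw [← h, toLex_ofLex]
    subst hw; simp
  · have hw : w = toLex (Sum.inr i) := by rw [← h, toLex_ofLex]
    subst hw; simp; omega

variable (Nf L) in
/-- The upper slice generators `U₀`. [cite: MontvayMunster1994, §4.2.3 (4.102)] -/
def upperGens : Finset (FermiIdx Nf L ⊕ₗ FermiIdx Nf L) := (zeroGens Nf L).filter IsUpper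

variable (Nf L) in
/-- The lower slice generators `Z ∖ U₀`. [cite: MontvayMunster1994, §4.2.3 (4.102)] -/
def lowerGens : Finset (FermiIdx Nf L ⊕ₗ FermiIdx Nf L) := (zeroGens Nf L).filter fun w => ¬ IsUpper w

/-- Membership in `upperGens`. [folklore] -/
@[simp] theorem mem_upperGens {w : FermiIdx Nf L ⊕ₗ FermiIdx Nf L} :
    w ∈ upperGens Nf L ↔ genTimeT w = 0 ∧ IsUpper w := by simp [upperGens]

/-- Membership in `lowerGens`. [folklore] -/
@[simp] theorem mem_lowerGens {w : FermiIdx Nf L ⊕ₗ FermiIdx Nf L} :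
    w ∈ lowerGens Nf L ↔ genTimeT w = 0 ∧ ¬ IsUpper w := by simp [lowerGens]

/-- The reflection maps upper slice generators to lower ones. [folklore] -/
theorem reflGen_mem_lowerGens {w : FermiIdx Nf L ⊕ₗ FermiIdx Nf L} (hw : w ∈ upperGens Nf L) :
    reflGen w ∈ lowerGens Nf L := by
  rw [mem_upperGens] at hw
  rw [mem_lowerGens, isUpper_reflGen, not_not, genTimeT_reflGen, if_pos hw.1]
  exact ⟨rfl, hw.2⟩

end Indices

/-! ### `Θ'` on quadratic actions -/

section Quadratic

open GrassmannAlgebra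

variable {Nf L : ℕ} [NeZero L]

/-- The `Θ'`-conjugate of a fermion matrix in the rotated frame: `R'`-rotate the `Θ_T`-conjugate of
the `R`-rotated matrix. [folklore] -/
def thetaMatrixRot (A : Matrix (FermiIdx Nf L) (FermiIdx Nf L) ℂ) : Matrix (FermiIdx Nf L) (FermiIdx Nf L) ℂ :=
  spinBlock spinW * thetaMatrix (spinBlock ((2 : ℂ)⁻¹ • spinWᴴ) * A * (spinBlock ((2 : ℂ)⁻¹ • spinWᵀ))ᵀ) *
    (spinBlock (spinW.map star))ᵀ

/-- **`Θ' (ψ̄ A ψ) = ψ̄ A^{Θ'} ψ`**. [cite: MontvayMunster1994, §4.2.3 (4.92)] -/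
theorem fermiThetaRot_quadratic (A : Matrix (FermiIdx Nf L) (FermiIdx Nf L) ℂ) :
    fermiThetaRot (quadratic ℂ A) = quadratic ℂ (thetaMatrixRot A) := by
  rw [fermiThetaRot_apply, spinRot, map_blockSubst_quadratic, torusTheta_quadratic, spinUnrot,
    map_blockSubst_quadratic, thetaMatrixRot]

/-- `(W̄)ᵀ = Wᴴ` on spin blocks. [folklore] -/
theorem spinBlock_map_star_transpose :
    (spinBlock (Nf := Nf) (L := L) (spinW.map star))ᵀ = spinBlock spinWᴴ := by
  rw [spinBlock_transpose]; rfl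

/-- `R' (ψ̄ A ψ) = ψ̄ (W A Wᴴ) ψ` (blockwise). [folklore] -/
theorem spinUnrot_quadratic (A : Matrix (FermiIdx Nf L) (FermiIdx Nf L) ℂ) :
    spinUnrot (quadratic ℂ A) = quadratic ℂ (spinBlock spinW * A * spinBlock spinWᴴ) := by
  rw [spinUnrot, map_blockSubst_quadratic, spinBlock_map_star_transpose]

/-- **The rotated reflected matrix is the rotation of `thetaMatrix`**:
`(W A Wᴴ)^{Θ'} = W A^Θ Wᴴ`. [folklore] -/
theorem thetaMatrixRot_rot (A : Matrix (FermiIdx Nf L) (FermiIdx Nf L) ℂ) :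
    thetaMatrixRot (spinBlock spinW * A * spinBlock spinWᴴ) =
      spinBlock spinW * thetaMatrix A * spinBlock spinWᴴ := by
  rw [thetaMatrixRot, spinBlock_map_star_transpose]
  congr 2
  rw [spinBlock_transpose, ← Matrix.mul_assoc, ← Matrix.mul_assoc, spinBlock_half_conjTranspose_mul,
    Matrix.one_mul, Matrix.mul_assoc, spinBlock_mul]
  have h : spinWᴴ * ((2 : ℂ)⁻¹ • spinWᵀ)ᵀ = 1 := by
    rw [Matrix.transpose_smul, Matrix.transpose_transpose, Matrix.mul_smul, conjTranspose_mul_spinW, smul_smul,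
      inv_mul_cancel₀ two_ne_zero, one_smul]
  rw [h, spinBlock_one, Matrix.mul_one]

end Quadratic

/-! ### Positive-time observables in the frame -/

section Observable

open GrassmannAlgebra

local notation "𝔾" => Matrix.specialUnitaryGroup (Fin 3) ℂ

variable {Nf R L : ℕ} [NeZero L]

/-- A placed positive-time boxed quark variable sits at a torus time `1 ≤ t ≤ L/2` (`2R < L`). [folklore] -/
theorem idxTime_toTorusIdx (hRL : 2 * R < L) {w : BoxFermiIdx Nf R ⊕ₗ BoxFermiIdx Nf R}
    (hw : 1 ≤ genTime w) :
    1 ≤ idxTime (genIdx (QCDLatticeObservable.toTorusIdx (Nf := Nf) (R := R) L 0 w)) ∧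
      idxTime (genIdx (QCDLatticeObservable.toTorusIdx (Nf := Nf) (R := R) L 0 w)) ≤ L / 2 := by
  rcases h : ofLex w with i | i
  · have hw' : w = toLex (Sum.inl i) := by rw [← h, toLex_ofLex]
    subst hw'
    set q := boxQuarkEquiv.symm i with hq
    have ht : genTime (toLex (Sum.inl i) : BoxFermiIdx Nf R ⊕ₗ BoxFermiIdx Nf R) =
        ((q.2.1 : LatticeModels.Site 4) 0) := rfl
    have hbox := (mem_box.1 q.2.1.2) 0
    simp only [QCDLatticeObservable.toTorusIdx, ofLex_toLex, add_zero, genIdx_inl, idxTime_quarkEquiv,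
      Torus.proj_apply]
    rw [ht] at hw
    have hnn : (0 : ℤ) ≤ (q.2.1 : LatticeModels.Site 4) 0 := by omega
    obtain ⟨n, hn⟩ := Int.eq_ofNat_of_zero_le hnn
    rw [hn, Int.cast_natCast, ZMod.val_natCast_of_lt (by omega)]
    omega
  · have hw' : w = toLex (Sum.inr i) := by rw [← h, toLex_ofLex]
    subst hw'
    set q := boxQuarkEquiv.symm i with hq
    have ht : genTime (toLex (Sum.inr i) : BoxFermiIdx Nf R ⊕ₗ BoxFermiIdx Nf R) =
        ((q.2.1 : LatticeModels.Site 4) 0) := rfl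
    have hbox := (mem_box.1 q.2.1.2) 0
    simp only [QCDLatticeObservable.toTorusIdx, ofLex_toLex, add_zero, genIdx_inr, idxTime_quarkEquiv,
      Torus.proj_apply]
    rw [ht] at hw
    have hnn : (0 : ℤ) ≤ (q.2.1 : LatticeModels.Site 4) 0 := by omega
    obtain ⟨n, hn⟩ := Int.eq_ofNat_of_zero_le hnn
    rw [hn, Int.cast_natCast, ZMod.val_natCast_of_lt (by omega)]
    omega

/-- A generator whose quark variable has time in `[1, L/2]` is a spectator of `N ∪ Z`. [folklore] -/
theorem gen_mem_spectator_of_time {w : FermiIdx Nf L ⊕ₗ FermiIdx Nf L}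
    (h : 1 ≤ genTimeT w ∧ genTimeT w ≤ L / 2) :
    gen ℂ w ∈ spectatorSubalgebra ℂ (negGens Nf L ∪ zeroGens Nf L) := by
  refine gen_mem_spectatorSubalgebra ℂ ?_
  rw [Finset.mem_union, mem_negGens, mem_zeroGens]
  omega

/-- **A positive-time observable, placed on the torus and rotated, involves only positive-time
generators** (`2R < L`): `R' (A.onTorus L 0 U)` is a spectator of `N ∪ Z`. [cite: MontvayMunster1994, §4.2.3 (4.100)] -/
theorem spinUnrot_onTorus_mem (hRL : 2 * R < L) (A : QCDLatticeObservable Nf R) (hA : A.IsPositiveTime)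
    (U : GaugeConfig 4 L 𝔾) :
    spinUnrot (A.onTorus L 0 U) ∈ spectatorSubalgebra ℂ (negGens Nf L ∪ zeroGens Nf L) := by
  set T := spectatorSubalgebra ℂ (negGens Nf L ∪ zeroGens Nf L) with hT
  set h : BoxFermiAlg Nf R →ₐ[ℂ] FermiAlg Nf L :=
    (spinUnrot (Nf := Nf) (L := L)).comp (ExteriorAlgebra.map (placeLin Nf R L 0)) with hh
  have hgen : ∀ y ∈ {y : BoxFermiAlg Nf R | ∃ w : BoxFermiIdx Nf R ⊕ₗ BoxFermiIdx Nf R,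
      1 ≤ genTime w ∧ y = gen ℂ w}, h y ∈ T := by
    rintro y ⟨w, hw, rfl⟩
    have ht := idxTime_toTorusIdx (Nf := Nf) hRL hw
    rw [hh, AlgHom.comp_apply, gen, ExteriorAlgebra.map_apply_ι, placeLin_single]
    rcases hi : ofLex (QCDLatticeObservable.toTorusIdx (Nf := Nf) (R := R) L 0 w) with i | i
    · have hi' : QCDLatticeObservable.toTorusIdx (Nf := Nf) (R := R) L 0 w = toLex (Sum.inl i) := by
        rw [← hi, toLex_ofLex]
      rw [hi'] at ht ⊢
      obtain ⟨⟨f, x, a, α⟩, rfl⟩ := quarkEquiv.surjective i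
      change spinUnrot (qbar (f, (x, a, α))) ∈ T
      rw [spinUnrot_qbar]
      refine Subalgebra.sum_mem _ fun β _ => Subalgebra.smul_mem _ (gen_mem_spectator_of_time ?_) _
      simpa [genTimeT] using ht
    · have hi' : QCDLatticeObservable.toTorusIdx (Nf := Nf) (R := R) L 0 w = toLex (Sum.inr i) := by
        rw [← hi, toLex_ofLex]
      rw [hi'] at ht ⊢
      obtain ⟨⟨f, x, a, α⟩, rfl⟩ := quarkEquiv.surjective i
      change spinUnrot (q (f, (x, a, α))) ∈ T
      rw [spinUnrot_q]
      refine Subalgebra.sum_mem _ fun β _ => Subalgebra.smul_mem _ (gen_mem_spectator_of_time ?_) _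
      simpa [genTimeT] using ht
  have hle : Algebra.adjoin ℂ (h '' {y : BoxFermiAlg Nf R | ∃ w : BoxFermiIdx Nf R ⊕ₗ BoxFermiIdx Nf R,
      1 ≤ genTime w ∧ y = gen ℂ w}) ≤ T := Algebra.adjoin_le (by
    rintro _ ⟨y, hy, rfl⟩
    exact hgen y hy)
  have hmem : h (A.F (configShift (-0) (torusLift L U))) ∈ T := by
    refine hle ?_
    rw [← AlgHom.map_adjoin]
    exact Subalgebra.mem_map.2 ⟨_, hA.2 _, rfl⟩
  exact hmem

end Observable

end Literature.MathematicalPhysics.QuantumFieldTheory
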